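import Literature.NumberTheory.EllipticCurves.ZpExtensionEisensteinOrdinaryResidualStrictProofs
import Literature.NumberTheory.EllipticCurves.ZpExtensionEisensteinOrdinaryResidualLiftSurjectiveProofs
import Literature.NumberTheory.EllipticCurves.ZpExtensionEisensteinTwistedFilH2VanishingProofs
import Literature.NumberTheory.EllipticCurves.ZpExtensionEisensteinOrdinaryFilSaturationProofs
import Literature.NumberTheory.EllipticCurves.ZpExtensionEisensteinOrdinaryFilTransferProofs
import Literature.NumberTheory.EllipticCurves.ZpExtensionEisensteinTwistFreeProofs
import Literature.NumberTheory.EllipticCurves.ZpExtensionEisensteinDVRSetting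
import Literature.NumberTheory.EllipticCurves.TorsionFilAtStrictTransportProofs
import HarnessLib

/-!
# Howard's H.5(b) input at the places `w ∣ p`, non-anomalous case: the residual image of `F_𝔮(w)` for the curve's Eisenstein tower
# is the strict ordinary condition `ker (H¹(K_w, E[p]) → H¹(K_w, E[p]/Fil_w E[p]))` (theorems only; no definition, no named fact,
# no instance, no `sorry`)

Topic `NumberTheory/EllipticCurves` (D1 road of cell `pub/bsd-print-x9`; assembly (C2a) of seat `bsd-line-x10b-p1-w8` g2's (H5B-P), assembler
ruling LEAD g8 2026-08-28T20:16:54Z (R1)/(R2): per-place non-anomalous hypotheses, no frame change).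

Howard [B. Howard, Compositio Math. 140 (2004), §1.3 H.5(b), Def. 3.1.2, §3.1, Lemma 3.2.7 (arXiv:1202.6340 p. 7 L96–97, p. 15, p. 16)]:
for the curve's Eisenstein tower `W_j = E[p^j] ⊗ A_{m,j}(ψ)` with the ordinary data `Fil_w E[p^j] = E[p^j] ∩ E₁(K̄_w)`
(`ordinaryFiltrationAt`) at a place `w ∋ p` of good reduction with an ordinary point, ANY residual presentation `π̄ : W₁ ↠ E[p]` by
`([T])` with `π̄ (1 ⊗ a) = a` (`E[p]` an `A_{m,1}`-module through the residue character), every `m ≥ 1` and every character of the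
tower: **`WeierstrassCurve.propagate_eisensteinSelmerStructure_eq_strictSubgroup_torsionFilAt_of_nonanomalous`** —

  `(F_𝔮 propagated to E[p])(w) = ker (H¹(K_w, E[p]) → H¹(K_w, E[p] / Fil_w E[p]))`,

under the two NON-ANOMALOUS inputs at `w` (per place, as hypotheses; both ⟸ `Ẽ_w(k_w)[p] = 0`): (hna0) some `σ₀ ∈ Γ_{K_w}` acts on
`E[p]` modulo `Fil_w E[p]` as an integer `n₀ ≢ 1 (mod p)`; (hna2) every `Γ_{K_w}`-equivariant additive `Fil_w E[p] → μ_p` vanishes.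
Assembly of: the generic readout `ZpExtension.propagate_eisensteinSelmerStructure_one_eq_strictSubgroup` (x10b-p1-w8, C1) with x9-p1-w3's
E-inputs (map)/(ONTO)/(SAT) (`ZpExtensionEisensteinOrdinaryFilTransferProofs`, `…OrdinaryFilSaturationProofs`), x10b-p1-w8's (D3)
invariants vanishing, (D4) `H²(K_w, Fil_w W₁) = 0`, and the residual lift (C1-lift I/II).  The `v`-clause of H.5(b) then follows by
transport (`TorsionFilAtStrictTransportProofs`).  No summit statement is proved; BSD is not proved by any of this.

References: [Howard2004HeegnerKolyvagin] §1.3 H.5(b), Def. 3.1.2, §3.1, Lemma 3.2.7; [MazurRubinMemoirs2004] Def. 1.1.1, Example 1.1.2;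
[GreenbergLNM1716] §2; [SerreGaloisCohomology1997] I §2.2; [MilneADT2006] I Cor. 2.3.
-/

set_option autoImplicit false

noncomputable section

open Function NumberField IsDedekindDomain Field
open scoped NumberField TensorProduct ContRepresentation

namespace WeierstrassCurve

open Literature.NumberTheory.EllipticCurves Literature.NumberTheory.GaloisRepresentations
open Literature.NumberTheory.GaloisRepresentations.DiscreteGaloisModule
open Literature.NumberTheory.GaloisCohomology.Howard2004
open Literature.NumberTheory.EllipticCurves.IwasawaAlgebra Literature.NumberTheory.EllipticCurves.ZpExtension

variable {K : Type} [Field K] [NumberField K] (E : WeierstrassCurve K) [E.IsElliptic] {p : ℕ} [hp : Fact p.Prime]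
  (κ : ZpExtension K p) {m : ℕ} (hm : 1 ≤ m) (S : Finset (HeightOneSpectrum (𝓞 K))) (w : HeightOneSpectrum (𝓞 K))
  [Module (EisensteinCoeff p m 1) (geomTorsion E (p : ℤ))]
  (hN : ∀ (d : EisensteinCoeff p m 1) (n : geomTorsion E (p : ℤ)), d • n = (EisensteinCoeff.residueChar p hm (le_refl 1) d).val • n)
  (πbar : EisensteinCoeff.Twisted p m 1 (geomTorsion E ((p : ℤ) ^ 1)) →ₗ[EisensteinCoeff p m 1] geomTorsion E (p : ℤ))
  (hbar : IsQuotientBy (κ.eisensteinTwist (E.torsionGaloisModule ((p : ℤ) ^ 1)) hm 1)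
    (@IsLocalRing.maximalIdeal _ _ (EisensteinCoeff.isLocalRing_eisensteinCoeff p hm (le_refl 1)))
    (E.torsionGaloisModule (p : ℤ)) πbar)
  (hone : ∀ a : geomTorsion E ((p : ℤ) ^ 1),
    ((πbar (EisensteinCoeff.Twisted.tmul 1 a) : geomTorsion E (p : ℤ)) : geomPoints E) = (a : geomPoints E))

include hN hone in
/-- **The residual image of `F_𝔮` at a non-anomalous `w ∣ p` is the strict ordinary condition of `E[p]`.**  For the curve's
Eisenstein tower with ordinary data `Fil_w E[p^j] = E[p^j] ∩ E₁(K̄_w)` at a place `w ∋ p` of good reduction with an ordinary point,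
any residual presentation `π̄ : W₁ ↠ E[p]` by `([T])` with `π̄(1 ⊗ a) = a`, and the per-place non-anomalous inputs (hna0)
«`σ₀` acts on `E[p]` mod `Fil_w E[p]` as `n₀ ≢ 1 (mod p)`» and (hna2) «every `Γ_{K_w}`-equivariant additive `Fil_w E[p] → μ_p` is
zero»: `(F_𝔮 propagated to E[p])(w) = ker (H¹(K_w, E[p]) → H¹(K_w, E[p]/Fil_w E[p]))`, for every `m ≥ 1` and every `ψ`.
[cite: Howard2004HeegnerKolyvagin, §1.3 H.5(b), Def. 3.1.2, §3.1 and Lemma 3.2.7 (arXiv:1202.6340 p. 7 L96–97, p. 15 L56–66 and L99–108, p. 16 L150–160)]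
[cite: GreenbergLNM1716, §2] [cite: MazurRubinMemoirs2004, Def. 1.1.1 and Example 1.1.2] -/
theorem propagate_eisensteinSelmerStructure_eq_strictSubgroup_torsionFilAt_of_nonanomalous
    (hpw : (p : 𝓞 K) ∈ w.asIdeal) (hgood : E.HasGoodReductionAt w)
    (hord : ∃ P : localPoints E (w.adicCompletion K), (p : ℤ) • P = 0 ∧ P ∉ E.localKernelOfReduction w)
    (hna0 : ∃ (σ₀ : absoluteGaloisGroup (w.adicCompletion K)) (n₀ : ℤ), ¬ (p : ℤ) ∣ n₀ - 1 ∧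
      ∀ a : geomTorsion E ((p : ℤ) ^ 1),
        GaloisRep.toLocal w (E.torsionGaloisModule ((p : ℤ) ^ 1)) σ₀ a - n₀ • a ∈
          (E.ordinaryFiltrationAt w (fun j ↦ E.torsionGaloisModuleReduce p j) (fun _ _ ↦ rfl)).fil 1)
    (hna2 : ∀ g : (E.ordinaryFiltrationAt w (fun j ↦ E.torsionGaloisModuleReduce p j) (fun _ _ ↦ rfl)).fil 1 →+
        MuCarrier (w.adicCompletion K) (p ^ 1),
      (∀ (σ : absoluteGaloisGroup (w.adicCompletion K))
        (a : (E.ordinaryFiltrationAt w (fun j ↦ E.torsionGaloisModuleReduce p j) (fun _ _ ↦ rfl)).fil 1),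
        g ⟨GaloisRep.toLocal w (E.torsionGaloisModule ((p : ℤ) ^ 1)) σ a,
          (E.ordinaryFiltrationAt w (fun j ↦ E.torsionGaloisModuleReduce p j) (fun _ _ ↦ rfl)).smul_mem 1 σ a a.2⟩ =
          mu (w.adicCompletion K) (p ^ 1) σ (g a)) → g = 0) :
    hbar.propagateStructure (κ.eisensteinSelmerStructure (fun j ↦ E.torsionGaloisModule ((p : ℤ) ^ j))
      (fun j ↦ E.torsionGaloisModuleReduce p j) hm S
      (fun v _ ↦ E.ordinaryFiltrationAt v (fun j ↦ E.torsionGaloisModuleReduce p j) (fun _ _ ↦ rfl)) 1) (Sum.inr w) =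
      DiscreteGaloisModule.strictSubgroup (GaloisRep.toLocal w (E.torsionGaloisModule (p : ℤ))) (E.torsionFilAt w (p : ℤ))
        (E.torsionFilAt_le_comap w (p : ℤ)) := by
  have hpK : (p : K) ≠ 0 := Nat.cast_ne_zero.2 hp.out.ne_zero
  haveI : ∀ k, Finite (geomTorsion E ((p : ℤ) ^ k)) := fun k ↦
    finite_torsionPoints_holds E (AlgebraicClosure K) (pow_ne_zero k (by exact_mod_cast hp.out.ne_zero))
  have htt := E.torsionGaloisModule_transition_hypotheses (fun j ↦ E.torsionGaloisModuleReduce p j)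
    (fun j P ↦ E.coe_torsionGaloisModuleReduce p j P)
  set Φw := E.ordinaryFiltrationAt w (fun j ↦ E.torsionGaloisModuleReduce p j) (fun _ _ ↦ rfl) with hΦw
  obtain ⟨σ₀, n₀, hn₀, hσ₀⟩ := hna0
  refine ZpExtension.propagate_eisensteinSelmerStructure_one_eq_strictSubgroup κ (fun j ↦ E.torsionGaloisModule ((p : ℤ) ^ j))
    (fun j ↦ E.torsionGaloisModuleReduce p j) hm htt.1 htt.2.1 htt.2.2
    (fun k ↦ (E.nonempty_geomTorsion_prime_pow_addEquiv_fin_two hpK k).some) S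
    (fun v _ ↦ E.ordinaryFiltrationAt v (fun j ↦ E.torsionGaloisModuleReduce p j) (fun _ _ ↦ rfl)) w hpw
    (fun k y hy ↦ E.exists_mem_torsionFilAt_reduce_eq w hgood hpw hord _ (fun _ _ ↦ rfl) k y hy)
    (fun ℓ n x' hx' ↦ E.exists_mem_twistedFil_transfer_eq_ordinaryFiltrationAt w κ hm _ (fun _ _ ↦ rfl) hgood hpw hord ℓ n x' hx')
    (fun ℓ n x hx ↦ E.mem_twistedFil_of_transfer_mem_ordinaryFiltrationAt w κ hm _ (fun _ _ ↦ rfl) hgood hpw hord ℓ n x hx)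
    (fun v hv ↦ Φw.quotient_twistedFil_one_eq_zero_of_forall_apply_eq κ hm σ₀ n₀ hn₀ hσ₀ v hv)
    (Φw.subsingleton_continuousCohomology_two_twistedFil_one κ hm hna2)
    (E.torsionGaloisModule (p : ℤ)) πbar hbar (E.torsionFilAt w (p : ℤ)) (E.torsionFilAt_le_comap w (p : ℤ))
    (fun _ hx ↦ E.πbar_mem_torsionFilAt_of_mem_twistedFil hm w hN πbar hone hx)
    (E.surjective_cohomologyMap_restrict_πbar_twistedFil κ hm w hN πbar hbar hone hpw hgood hord hna2)

end WeierstrassCurve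

/-! ## The `hfin` clause of `eisensteinDVRSetting_h5b_of` at tower level `0`, for `v ∋ p` non-anomalous at `v` and `σ v` -/

namespace WeierstrassCurve

open Literature.NumberTheory.EllipticCurves Literature.NumberTheory.GaloisRepresentations
open Literature.NumberTheory.GaloisRepresentations.DiscreteGaloisModule
open Literature.NumberTheory.GaloisCohomology.Howard2004
open Literature.NumberTheory.EllipticCurves.IwasawaAlgebra Literature.NumberTheory.EllipticCurves.ZpExtension

variable {K : Type} [Field K] [NumberField K] (W : WeierstrassCurve ℚ) [W.IsElliptic] {p : ℕ} [hp : Fact p.Prime]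
  (κ : ZpExtension K p) {m : ℕ} (hm : 1 ≤ m)
  (S : Finset (HeightOneSpectrum (𝓞 K)))
  (hpS : ∀ v : HeightOneSpectrum (𝓞 K), ((p : ℕ) : 𝓞 K) ∈ v.asIdeal → v ∈ S)
  (hbad : ∀ v : HeightOneSpectrum (𝓞 K), v ∉ S → ((p : ℕ) : 𝓞 K) ∉ v.asIdeal → (W.baseChange K).HasGoodReductionAt v)
  (L : Set (HeightOneSpectrum (𝓞 K)))
  (hL : letI := IwasawaAlgebra.isLocalRing_quotient_X_pow_add_C p hm
    L ⊆ (W.eisensteinTower κ hm).degreeTwoPrimes p)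
  (hLS : ∀ v ∈ L, v ∉ S)
  (jbar : AlgebraicClosure K →+* ℂ)
  (σ : K ≃ₐ[ℚ] K) (hσ₁ : σ ≠ 1) (hσ : σ * σ = 1) (τ : AlgebraicClosure K ≃+* AlgebraicClosure K)
  (hτ : IsLiftOfAut σ τ) (hτ₂ : Function.Involutive τ)
  (D : letI := IwasawaAlgebra.isLocalRing_quotient_X_pow_add_C p hm
    ∀ k, DualityDatum p (ConjugationDatum.ofLifts σ hσ₁ hσ τ hτ hτ₂) ((W.eisensteinTower κ hm).ρ k)
      (IwasawaAlgebra.EisensteinCoeff p m (k + 1)))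
  (fs : letI := IwasawaAlgebra.isLocalRing_quotient_X_pow_add_C p hm
    ∀ (k : ℕ) (n : Finset (HeightOneSpectrum (𝓞 K))) (v : HeightOneSpectrum (𝓞 K)),
      galoisCohomology ((W.eisensteinLevelQuot κ hm k n).toLocal (Sum.inr v)) 1 →+
        SingularQuotient (GaloisRep.toLocal v (W.eisensteinLevelQuot κ hm k n)) ⊗[ℤ] Gell v)

/-- **H.5(b), bottom level, at `v ∈ S` above `p`, non-anomalous case, for the curve's Eisenstein setting
`WeierstrassCurve.eisensteinDVRSetting`** (the `hfin` clause of `eisensteinDVRSetting_h5b_of` at `k = 0`, conjugation datum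
`ConjugationDatum.ofLifts σ …`): if `p ∈ v`, `p ∈ σ v`, and at `w = v` and `w = σ v` the curve has good reduction with an ordinary
point and is non-anomalous in the two per-place forms (hna0) «some `σ₀ ∈ Γ_{K_w}` acts on `E[p]` mod `Fil_w E[p]` as `n₀ ≢ 1 (mod p)`»
and (hna2) «every `Γ_{K_w}`-equivariant additive `Fil_w E[p] → μ_p` is zero», then `(θ_v ∘ transport_v)(F̄_𝔮(σ v)) = F̄_𝔮(v)` at
tower level `0`: both sides are the strict ordinary conditions (previous theorem), which `θ_v ∘ transport_v` matches since
`τ(Fil_{σ v} E[p]) = Fil_v E[p]` (`TorsionFilAtStrictTransportProofs`).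
[cite: Howard2004HeegnerKolyvagin, §1.3 H.5(b), Def. 3.1.2, §3.1 and Lemma 3.2.7 (arXiv:1202.6340 p. 7 L96–97, p. 15 L56–66 and L99–108, p. 16 L150–160)]
[cite: MazurRubinMemoirs2004, Def. 1.1.1 and Example 1.1.2] [cite: GreenbergLNM1716, §2] -/
theorem eisensteinDVRSetting_h5b_clause_zero_of_mem_of_nonanomalous
    {v : HeightOneSpectrum (𝓞 K)} (hpv : ((p : ℕ) : 𝓞 K) ∈ v.asIdeal)
    (hpσv : ((p : ℕ) : 𝓞 K) ∈ ((ConjugationDatum.ofLifts σ hσ₁ hσ τ hτ hτ₂).σ • v).asIdeal)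
    (hgood : ∀ w ∈ ({v, (ConjugationDatum.ofLifts σ hσ₁ hσ τ hτ hτ₂).σ • v} : Set (HeightOneSpectrum (𝓞 K))),
      (W.baseChange K).HasGoodReductionAt w)
    (hord : ∀ w ∈ ({v, (ConjugationDatum.ofLifts σ hσ₁ hσ τ hτ hτ₂).σ • v} : Set (HeightOneSpectrum (𝓞 K))),
      ∃ P : localPoints (W.baseChange K) (w.adicCompletion K), (p : ℤ) • P = 0 ∧ P ∉ (W.baseChange K).localKernelOfReduction w)
    (hna0 : ∀ w ∈ ({v, (ConjugationDatum.ofLifts σ hσ₁ hσ τ hτ hτ₂).σ • v} : Set (HeightOneSpectrum (𝓞 K))),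
      ∃ (σ₀ : absoluteGaloisGroup (w.adicCompletion K)) (n₀ : ℤ), ¬ (p : ℤ) ∣ n₀ - 1 ∧
        ∀ a : geomTorsion (W.baseChange K) ((p : ℤ) ^ 1),
          GaloisRep.toLocal w ((W.baseChange K).torsionGaloisModule ((p : ℤ) ^ 1)) σ₀ a - n₀ • a ∈
            ((W.baseChange K).ordinaryFiltrationAt w (fun j ↦ (W.baseChange K).torsionGaloisModuleReduce p j)
              (fun _ _ ↦ rfl)).fil 1)
    (hna2 : ∀ w ∈ ({v, (ConjugationDatum.ofLifts σ hσ₁ hσ τ hτ hτ₂).σ • v} : Set (HeightOneSpectrum (𝓞 K))),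
      ∀ g : ((W.baseChange K).ordinaryFiltrationAt w (fun j ↦ (W.baseChange K).torsionGaloisModuleReduce p j)
          (fun _ _ ↦ rfl)).fil 1 →+ MuCarrier (w.adicCompletion K) (p ^ 1),
        (∀ (σ' : absoluteGaloisGroup (w.adicCompletion K))
          (a : ((W.baseChange K).ordinaryFiltrationAt w (fun j ↦ (W.baseChange K).torsionGaloisModuleReduce p j)
            (fun _ _ ↦ rfl)).fil 1),
          g ⟨GaloisRep.toLocal w ((W.baseChange K).torsionGaloisModule ((p : ℤ) ^ 1)) σ' a,
            ((W.baseChange K).ordinaryFiltrationAt w (fun j ↦ (W.baseChange K).torsionGaloisModuleReduce p j)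
              (fun _ _ ↦ rfl)).smul_mem 1 σ' a a.2⟩ = mu (w.adicCompletion K) (p ^ 1) σ' (g a)) → g = 0) :
    letI := IwasawaAlgebra.isDomain_quotient_X_pow_add_C p hm
    letI := IwasawaAlgebra.isDiscreteValuationRing_quotient_X_pow_add_C p hm
    haveI := IwasawaAlgebra.EisensteinCoeff.isLocalRing_succ p hm
    letI := IwasawaAlgebra.EisensteinCoeff.algebraOfSpecSucc p m
    haveI := W.isScalarTower_algebraOfSpecSucc (K := K) (p := p) (m := m)
    letI := W.residueModuleSucc (K := K) (p := p) hm
    AddSubgroup.map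
        (((W.residualTauGeomTorsion (p := p) (ConjugationDatum.ofLifts σ hσ₁ hσ τ hτ hτ₂) hm (k := 0 + 1)
            (Nat.succ_pos 0)).thetaH1 (Sum.inr v)).comp
          ((ConjugationDatum.ofLifts σ hσ₁ hσ τ hτ hτ₂).transportH1 ((W.baseChange K).torsionGaloisModule (p : ℤ)) v))
        (((W.isQuotientBy_eisensteinDVRSetting_πbar κ hm S hpS hbad L hL hLS jbar
            (ConjugationDatum.ofLifts σ hσ₁ hσ τ hτ hτ₂) D fs 0).propagateStructure
          (W.eisensteinTowerTriple κ hm S hpS hbad L hL hLS 0).cond)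
          (Sum.inr ((ConjugationDatum.ofLifts σ hσ₁ hσ τ hτ hτ₂).σ • v))) =
      ((W.isQuotientBy_eisensteinDVRSetting_πbar κ hm S hpS hbad L hL hLS jbar
          (ConjugationDatum.ofLifts σ hσ₁ hσ τ hτ hτ₂) D fs 0).propagateStructure
        (W.eisensteinTowerTriple κ hm S hpS hbad L hL hLS 0).cond) (Sum.inr v) := by
  letI := IwasawaAlgebra.isDomain_quotient_X_pow_add_C p hm
  letI := IwasawaAlgebra.isDiscreteValuationRing_quotient_X_pow_add_C p hm
  haveI := IwasawaAlgebra.EisensteinCoeff.isLocalRing_succ p hm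
  letI := IwasawaAlgebra.EisensteinCoeff.algebraOfSpecSucc p m
  haveI := W.isScalarTower_algebraOfSpecSucc (K := K) (p := p) (m := m)
  letI := W.residueModuleSucc (K := K) (p := p) hm
  have hone : ∀ a : geomTorsion (W.baseChange K) ((p : ℤ) ^ 1),
      ((((W.eisensteinDVRSetting κ hm S hpS hbad L hL hLS jbar (ConjugationDatum.ofLifts σ hσ₁ hσ τ hτ hτ₂) D fs).πbar 0
        (EisensteinCoeff.Twisted.tmul 1 a) : geomTorsion (W.baseChange K) (p : ℤ)) : geomPoints (W.baseChange K))) =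
        (a : geomPoints (W.baseChange K)) := fun a ↦ by
    have h := W.coe_eisensteinDVRSetting_πbar_tmul κ hm S hpS hbad L hL hLS jbar
      (ConjugationDatum.ofLifts σ hσ₁ hσ τ hτ hτ₂) D fs 0 a
    rwa [pow_zero, one_smul] at h
  have hw : ∀ w ∈ ({v, (ConjugationDatum.ofLifts σ hσ₁ hσ τ hτ hτ₂).σ • v} : Set (HeightOneSpectrum (𝓞 K))),
      ((p : ℕ) : 𝓞 K) ∈ w.asIdeal →
      ((W.isQuotientBy_eisensteinDVRSetting_πbar κ hm S hpS hbad L hL hLS jbar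
          (ConjugationDatum.ofLifts σ hσ₁ hσ τ hτ hτ₂) D fs 0).propagateStructure
        (W.eisensteinTowerTriple κ hm S hpS hbad L hL hLS 0).cond) (Sum.inr w) =
      DiscreteGaloisModule.strictSubgroup (GaloisRep.toLocal w ((W.baseChange K).torsionGaloisModule (p : ℤ)))
        ((W.baseChange K).torsionFilAt w (p : ℤ)) ((W.baseChange K).torsionFilAt_le_comap w (p : ℤ)) := by
    intro w hwv hpw
    obtain ⟨σ₀, n₀, hn₀, hσ₀⟩ := hna0 w hwv
    exact (W.baseChange K).propagate_eisensteinSelmerStructure_eq_strictSubgroup_torsionFilAt_of_nonanomalous κ hm S w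
      (fun d n ↦ EisensteinCoeff.residueModule_smul p hm (Nat.succ_pos 0) _ d n) _
      (W.isQuotientBy_eisensteinDVRSetting_πbar κ hm S hpS hbad L hL hLS jbar
        (ConjugationDatum.ofLifts σ hσ₁ hσ τ hτ hτ₂) D fs 0)
      hone hpw (hgood w hwv) (hord w hwv) ⟨σ₀, n₀, hn₀, hσ₀⟩ (hna2 w hwv)
  rw [hw _ (by simp) hpσv, hw _ (by simp) hpv]
  exact W.map_thetaH1_comp_transportH1_strictSubgroup_torsionFilAt_eq σ hσ₁ hσ τ hτ hτ₂ hm (Nat.succ_pos 0) v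

end WeierstrassCurve

end
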